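/-
HONEST FRAMING: certified error envelopes and provably optimal rounding/accumulation schemes for
low-precision formats under stated cost models; every table by two implementations; no hardware
or vendor claims.  OPTIMA.md §B, Theorem T9(h′) — THE PLACEMENT LAW WITH WIDE DELIVERY
(CM-B/placement, result allowed to stay wide); companion of `OptChainLabelsPlacement.lean`.
-/
import Summits.Ventures.CertifiedArithmetic.LowPrec.OptChainLabelsPlacement

/-!
# The placement law, wide delivery

Setting of `OptChainLabelsPlacement.lean`: a running sum of nonnegative terms kept in the narrow
`F(p)`, a budget of wide additions in `F(q)`, `p < q`, the narrow adder accepting `F(p)` operands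
only — so a demotion `(p, true)` precedes every narrow addition that follows a wide one — but here
the result may be delivered wide: a FINAL wide run is not demoted (`placePatW`).

* `ueffP_placePatW`: the effective constant of the placement `w` is
  `UW(w) = (n-k) u_p + k u_q + d(w) u_p`, `d(w)` = the number of wide runs FOLLOWED BY A NARROW
  ADDITION (`demots`).
* `placementW_exact_le` / `placementW_attained`: `1 + UW(w)` is the exact worst case of scheme `w`
  over all nearest roundings (bound for every admissible chain, attained for every `w`).
* THE OPTIMUM MOVES TO THE END: `placeUW_ge` (`UW(w) ≥ (n-k) u_p + k u_q`), with equality iff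
  NO demotion is executed iff the wide additions form a SUFFIX (`placeUW_eq_min_iff`,
  `demots_eq_zero_iff`); a suffix of `k ≥ 1` wide additions ALWAYS beats the all-narrow scheme
  (`placeUW_suffix_lt_allNarrow`), and the best narrow-delivery scheme costs exactly `u_p` more
  than the best wide-delivery one (`placeU_contig_eq_placeUW_suffix_add`).
* RNE: `q ≥ p + 2`: every ties-to-even family attains `1 + UW(w)` on every placement
  (`placementW_rne_attained`); `q = p + 1`: strict on every placement executing a demotion
  (`placementW_rne_strict`) — a suffix placement executes none (all additions: T9(b) attains).
* Registered: `R4_PlacementLawWide`, `R4_PlacementLawWideRNE` (+ `_holds`). -/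

namespace Summit.Ventures.CertifiedArithmetic.LowPrec.Opt

open Literature.ComputerArithmetic.JeannerodRump2018

/-! ## The scheme family with wide delivery -/

/-- The chain of the placement `w` with WIDE DELIVERY: as `placePat`, but a final wide run is not
demoted. -/
def placePatW (q p : ℕ) : Bool → List Bool → List (ℕ × Bool)
  | _, [] => []
  | false, false :: w => (p, false) :: placePatW q p false w
  | false, true :: w => (q, false) :: placePatW q p true w
  | true, true :: w => (q, false) :: placePatW q p true w
  | true, false :: w => (p, true) :: (p, false) :: placePatW q p false w

/-- Number of demotions executed: wide runs followed by a narrow addition. -/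
def demots : Bool → List Bool → ℕ
  | _, [] => 0
  | true, false :: w => demots false w + 1
  | false, false :: w => demots false w
  | false, true :: w => demots true w
  | true, true :: w => demots true w

/-- THE WIDE-DELIVERY PLACEMENT CONSTANT `UW(w)`. -/
def placeUW (q p : ℕ) (b : Bool) (w : List Bool) : ℚ :=
  (nN w : ℚ) * unitRoundoff p + (nW w : ℚ) * unitRoundoff q + (demots b w : ℚ) * unitRoundoff p

/-! ## The closed form of the effective constant -/

/-- COMBINATORIAL CORE: the effective unit-roundoff sum of the wide-delivery chain of `w` is
`UW(w)`. -/
theorem ueffP_placePatW {q p : ℕ} (hpq : p < q) :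
    ∀ (w : List Bool) (b : Bool), ueffP (stPrec q p b) (placePatW q p b w) = placeUW q p b w
  | [], b => by cases b <;> simp [placePatW, ueffP, placeUW, nN, nW, demots]
  | false :: w, false => by
      have ih := ueffP_placePatW hpq w false
      simp only [stPrec] at ih ⊢
      simp only [placePatW, ueffP, ih, placeUW, nN, nW, demots]
      push_cast; ring
  | true :: w, false => by
      have ih := ueffP_placePatW hpq w true
      simp only [stPrec] at ih ⊢
      simp only [placePatW, ueffP, ih, placeUW, nN, nW, demots]
      push_cast; ring
  | true :: w, true => by
      have ih := ueffP_placePatW hpq w true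
      simp only [stPrec] at ih ⊢
      simp only [placePatW, ueffP, ih, placeUW, nN, nW, demots]
      push_cast; ring
  | false :: w, true => by
      have ih := ueffP_placePatW hpq w false
      simp only [stPrec] at ih ⊢
      simp only [placePatW, ueffP, if_neg (not_le.mpr hpq), ih, placeUW, nN, nW, demots]
      push_cast; ring

/-- The precisions occurring in a wide-delivery placement chain are `p` and `q`. -/
theorem mem_placePatW {q p : ℕ} :
    ∀ (w : List Bool) (b : Bool) (r : ℕ × Bool), r ∈ placePatW q p b w → r.1 = p ∨ r.1 = q
  | [], b, r, h => by cases b <;> simp [placePatW] at h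
  | false :: w, false, r, h => by
      simp only [placePatW, List.mem_cons] at h
      rcases h with h | h
      · simp [h]
      · exact mem_placePatW w false r h
  | true :: w, false, r, h => by
      simp only [placePatW, List.mem_cons] at h
      rcases h with h | h
      · simp [h]
      · exact mem_placePatW w true r h
  | true :: w, true, r, h => by
      simp only [placePatW, List.mem_cons] at h
      rcases h with h | h
      · simp [h]
      · exact mem_placePatW w true r h
  | false :: w, true, r, h => by
      simp only [placePatW, List.mem_cons] at h
      rcases h with h | h | h
      · simp [h]
      · simp [h]
      · exact mem_placePatW w false r h

/-- A wide-delivery placement chain starts with an addition. -/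
theorem Rsum_placePatW (q p e : ℕ) : ∀ w : List Bool, Rsum e (placePatW q p false w) = 0
  | [] => by simp [placePatW, Rsum]
  | false :: w => by simp [placePatW, Rsum]
  | true :: w => by simp [placePatW, Rsum]

/-! ## The law: bound for every scheme, attained for every scheme -/

/-- UPPER BOUND: every admissible chain executing `w` with wide delivery from `acc ∈ F(p)`,
`acc ≥ 0` (any nearest roundings, nonnegative grid data): `acc + Σ x_i ≤ (1 + UW(w)) S_n`. -/
theorem placementW_exact_le {emin : ℤ} {q p : ℕ} (hpq : p < q) (w : List Bool)
    (ss : List LStep) (hpat : ss.map lpat = placePatW q p false w) (acc : ℚ) (hacc0 : 0 ≤ acc)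
    (haccF : IsFloat p emin acc) (hok : ∀ s ∈ ss, s.OK emin) :
    acc + xsum ss ≤ (1 + placeUW q p false w) * lchainEval acc ss := by
  have h := exact_le_lchain_eff ss acc hacc0 haccF hok
  rwa [ueff_eq_ueffP, hpat, show ueffP p (placePatW q p false w) = placeUW q p false w by
    simpa [stPrec] using ueffP_placePatW hpq w false] at h

/-- SHARPNESS: for every `w`, ties-downward nearest roundings and the T9(f) witness data give
`S_n = 2^E` and `acc + Σ x_i = (1 + UW(w)) S_n`. -/
theorem placementW_attained {emin E : ℤ} {fl : ℕ → ℚ → ℚ}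
    (hfl : ∀ π, IsRoundNearest π emin (fl π) ∧ TiesDown π emin (fl π))
    {q p : ℕ} (hp : 1 ≤ p) (hpq : p < q) (hE : emin + q ≤ E) (w : List Bool) :
    (witSteps fl E (placePatW q p false w)).map lpat = placePatW q p false w ∧
    (∀ s ∈ witSteps fl E (placePatW q p false w), s.OK emin) ∧
    lchainEval ((2 : ℚ) ^ E) (witSteps fl E (placePatW q p false w)) = (2 : ℚ) ^ E ∧
    (2 : ℚ) ^ E + xsum (witSteps fl E (placePatW q p false w))
      = (1 + placeUW q p false w) * (2 : ℚ) ^ E := by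
  have hP : ∀ r ∈ placePatW q p false w, 1 ≤ r.1 ∧ emin + r.1 ≤ E := by
    intro r hr
    rcases mem_placePatW w false r hr with h | h <;> (rw [h]; constructor <;> omega)
  have h := lchain_eff_attained hfl hp (by omega) (placePatW q p false w) hP
  rw [Rsum_placePatW] at h
  simp only [add_zero, mul_one] at h
  obtain ⟨-, hok, hev, heq⟩ := h
  refine ⟨map_witSteps fl E _, hok, hev, ?_⟩
  rw [heq, hev, ueff_witSteps]
  simpa [stPrec] using congrArg (fun t => (1 + t) * (2 : ℚ) ^ E) (ueffP_placePatW hpq w false)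

/-! ## The optimum: the wide additions LAST -/

/-- LOWER BOUND OVER SCHEMES: `UW(w) ≥ (n-k) u_p + k u_q`. -/
theorem placeUW_ge (q p : ℕ) (b : Bool) (w : List Bool) :
    (nN w : ℚ) * unitRoundoff p + (nW w : ℚ) * unitRoundoff q ≤ placeUW q p b w := by
  have hu := unitRoundoff_nonneg p
  unfold placeUW
  have : (0 : ℚ) ≤ (demots b w : ℚ) * unitRoundoff p := by positivity
  linarith

/-- Inside a wide run, no demotion is executed iff every remaining addition is wide. -/
theorem demots_true_eq_zero_iff : ∀ w : List Bool, demots true w = 0 ↔ w = List.replicate w.length true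
  | [] => by simp [demots]
  | true :: w => by
      rw [demots, demots_true_eq_zero_iff w]
      simp [List.replicate_succ]
  | false :: w => by simp [demots, List.replicate_succ]

/-- NO DEMOTION IFF SUFFIX: a placement executes no demotion iff its wide additions form a suffix. -/
theorem demots_eq_zero_iff (w : List Bool) :
    demots false w = 0 ↔ ∃ a k : ℕ, w = List.replicate a false ++ List.replicate k true := by
  induction w with
  | nil =>
      simp only [demots, true_iff]
      exact ⟨0, 0, by simp⟩
  | cons c w ih =>
      cases c with
      | true =>
          have key := demots_true_eq_zero_iff w
          rw [demots, key]
          constructor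
          · intro h
            exact ⟨0, w.length + 1, by rw [h]; simp [List.replicate_succ]⟩
          · rintro ⟨a, k, h⟩
            cases a with
            | succ a => simp [List.replicate_succ] at h
            | zero =>
                cases k with
                | zero => simp at h
                | succ k =>
                    simp only [List.replicate_zero, List.nil_append, List.replicate_succ,
                      List.cons.injEq, true_and] at h
                    rw [h]; simp
      | false =>
          rw [demots, ih]
          constructor
          · rintro ⟨a, k, h⟩
            exact ⟨a + 1, k, by rw [h]; simp [List.replicate_succ]⟩
          · rintro ⟨a, k, h⟩
            cases a with
            | zero =>
                cases k with
                | zero => simp at h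
                | succ k => simp [List.replicate_succ] at h
            | succ a =>
                simp only [List.replicate_succ, List.cons_append, List.cons.injEq, true_and] at h
                exact ⟨a, k, h⟩

/-- THE OPTIMUM WITH WIDE DELIVERY: `UW(w)` equals its lower bound `(n-k) u_p + k u_q` iff the wide
additions form a SUFFIX of the placement. -/
theorem placeUW_eq_min_iff (q p : ℕ) (w : List Bool) :
    placeUW q p false w = (nN w : ℚ) * unitRoundoff p + (nW w : ℚ) * unitRoundoff q ↔
      ∃ a k : ℕ, w = List.replicate a false ++ List.replicate k true := by
  rw [← demots_eq_zero_iff]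
  have hu : 0 < unitRoundoff p := by unfold unitRoundoff; positivity
  unfold placeUW
  constructor
  · intro h
    have h0 : (demots false w : ℚ) * unitRoundoff p = 0 := by linarith
    rcases mul_eq_zero.mp h0 with h1 | h1
    · exact_mod_cast h1
    · exact absurd h1 hu.ne'
  · intro h
    rw [h]; push_cast; ring

/-- The value of a suffix placement: `a` narrow additions then `k` wide ones cost
`a u_p + k u_q`. -/
theorem placeUW_suffix (q p a k : ℕ) :
    placeUW q p false (List.replicate a false ++ List.replicate k true)
      = (a : ℚ) * unitRoundoff p + (k : ℚ) * unitRoundoff q := by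
  have h0 : demots false (List.replicate a false ++ List.replicate k true) = 0 :=
    (demots_eq_zero_iff _).mpr ⟨a, k, rfl⟩
  rw [placeUW, h0, nN_append, nW_append, nN_replicate_false, nN_replicate_true,
    nW_replicate_false, nW_replicate_true]
  push_cast; ring

/-- WITH WIDE DELIVERY WIDENING ALWAYS PAYS: a suffix of `k + 1` wide additions beats the
all-narrow scheme `n u_p`. -/
theorem placeUW_suffix_lt_allNarrow {q p : ℕ} (hpq : p < q) (a k : ℕ) :
    placeUW q p false (List.replicate a false ++ List.replicate (k + 1) true)
      < ((a + (k + 1) : ℕ) : ℚ) * unitRoundoff p := by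
  have hlt : unitRoundoff q < unitRoundoff p := by
    unfold unitRoundoff
    exact one_div_lt_one_div_of_lt (by positivity) (pow_lt_pow_right₀ (by norm_num) hpq)
  rw [placeUW_suffix]
  push_cast
  nlinarith

/-- DELIVERY COMPARISON: the best narrow-delivery scheme costs exactly `u_p` more. -/
theorem placeU_contig_eq_placeUW_suffix_add (q p a k c : ℕ) :
    placeU q p false (contig a (k + 1) c)
      = placeUW q p false (List.replicate (a + c) false ++ List.replicate (k + 1) true)
          + unitRoundoff p := by
  rw [placeU_contig, placeUW_suffix]

/-! ## Round-to-nearest-even -/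

/-- For `q ≥ p + 2` every wide-delivery placement chain satisfies the RNE criterion. -/
theorem rneGap_placePatW {q p : ℕ} (h2 : p + 2 ≤ q) :
    ∀ (w : List Bool) (b first : Bool), RNEGap (stPrec q p b) first (placePatW q p b w)
  | [], b, first => by cases b <;> simp [placePatW, RNEGap]
  | false :: w, false, first => by
      simp only [stPrec, placePatW, RNEGap]
      exact rneGap_placePatW h2 w false false
  | true :: w, false, first => by
      simp only [stPrec, placePatW, RNEGap]
      exact rneGap_placePatW h2 w true false
  | true :: w, true, first => by
      simp only [stPrec, placePatW, RNEGap]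
      exact rneGap_placePatW h2 w true false
  | false :: w, true, first => by
      simp only [stPrec, placePatW, RNEGap]
      exact ⟨by omega, Or.inr h2, rneGap_placePatW h2 w false false⟩

/-- For `q = p + 1` a wide-delivery placement chain that executes a demotion violates the RNE
criterion. -/
theorem not_rneGap_placePatW_succ {p : ℕ} :
    ∀ (w : List Bool) (b first : Bool), demots b w ≠ 0 → (b = true → first = false) →
      ¬ RNEGap (stPrec (p + 1) p b) first (placePatW (p + 1) p b w)
  | [], b, first, h, _ => by cases b <;> simp [demots] at h
  | false :: w, false, first, h, _ => by
      simp only [stPrec, placePatW, RNEGap]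
      exact not_rneGap_placePatW_succ w false false (by simpa [demots] using h) (fun h => by simp at h)
  | true :: w, false, first, h, _ => by
      simp only [stPrec, placePatW, RNEGap]
      exact not_rneGap_placePatW_succ w true false (by simpa [demots] using h) (fun _ => rfl)
  | true :: w, true, first, h, _ => by
      simp only [stPrec, placePatW, RNEGap]
      exact not_rneGap_placePatW_succ w true false (by simpa [demots] using h) (fun _ => rfl)
  | false :: w, true, first, _, hf => by
      have hf' := hf rfl
      subst hf'
      simp [stPrec, placePatW, RNEGap]

/-- RNE, `q ≥ p + 2`: EVERY ties-to-even family attains `1 + UW(w)` on EVERY placement. -/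
theorem placementW_rne_attained {emin E : ℤ} {fl : ℕ → ℚ → ℚ}
    (hfl : ∀ π, IsRoundNearest π emin (fl π) ∧ TiesToEven π emin (fl π))
    {q p : ℕ} (hp : 2 ≤ p) (h2 : p + 2 ≤ q) (hE : emin + q ≤ E) (w : List Bool) :
    (witSteps fl E (placePatW q p false w)).map lpat = placePatW q p false w ∧
    (∀ s ∈ witSteps fl E (placePatW q p false w), s.OK emin) ∧
    lchainEval ((2 : ℚ) ^ E) (witSteps fl E (placePatW q p false w)) = (2 : ℚ) ^ E ∧
    (2 : ℚ) ^ E + xsum (witSteps fl E (placePatW q p false w))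
      = (1 + placeUW q p false w) * (2 : ℚ) ^ E := by
  have hP : ∀ r ∈ placePatW q p false w, 2 ≤ r.1 ∧ emin + r.1 ≤ E := by
    intro r hr
    rcases mem_placePatW w false r hr with h | h <;> (rw [h]; constructor <;> omega)
  have hgap : RNEGap p true (placePatW q p false w) := by
    simpa [stPrec] using rneGap_placePatW h2 w false true
  have h := lchain_rne_attained hfl hp (by omega) (placePatW q p false w) hP hgap
  rw [Rsum_placePatW] at h
  simp only [add_zero, mul_one] at h
  obtain ⟨-, hok, hev, heq⟩ := h
  refine ⟨map_witSteps fl E _, hok, hev, ?_⟩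
  rw [heq, hev, ← ueff_witSteps_eq_usum fl E _ p true hgap, ueff_witSteps]
  simpa [stPrec] using congrArg (fun t => (1 + t) * (2 : ℚ) ^ E) (ueffP_placePatW (by omega) w false)

/-- RNE, `q = p + 1`: every ties-to-even family is STRICT on every placement that executes a
demotion (equivalently, by `demots_eq_zero_iff`, whose wide additions are not a suffix). -/
theorem placementW_rne_strict {emin : ℤ} {p : ℕ} (w : List Bool) (hw : demots false w ≠ 0)
    (ss : List LStep) (hpat : ss.map lpat = placePatW (p + 1) p false w) (acc : ℚ)
    (hacc0 : 0 ≤ acc) (haccF : IsFloat p emin acc)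
    (hss : ∀ s ∈ ss, s.OK emin ∧ TiesToEven s.prec emin s.fl) (hpos : 0 < lchainEval acc ss) :
    acc + xsum ss < (1 + usum ss) * lchainEval acc ss := by
  refine lchain_rne_strict ss acc hacc0 haccF hss ?_ hpos
  rw [hpat]
  simpa [stPrec] using not_rneGap_placePatW_succ w false true hw (fun h => by simp at h)

/-! ## Registered form -/

/-- THE PLACEMENT LAW WITH WIDE DELIVERY (OPTIMA.md §B, T9(h′)): for formats `1 ≤ p < q`,
(1) every admissible chain executing `w` (final wide run not demoted) from `acc ∈ F(p)`, `acc ≥ 0`,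
has `acc + Σ x_i ≤ (1 + UW(w)) S_n`; (2) for every `w` and scale `E ≥ emin + q` some admissible
chain from some `acc ∈ F(p)` has `S_n = 2^E` and equality; (3) `UW(w) ≥ (n-k) u_p + k u_q`, with
(4) equality iff the wide additions form a suffix; (5) a suffix of `k ≥ 1` wide additions beats
`n u_p`; (6) the best narrow-delivery scheme costs exactly `u_p` more. -/
def R4_PlacementLawWide : Prop :=
  ∀ (q p : ℕ), 1 ≤ p → p < q →
    (∀ (emin : ℤ) (w : List Bool) (ss : List LStep) (acc : ℚ),
        ss.map lpat = placePatW q p false w → 0 ≤ acc → IsFloat p emin acc →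
        (∀ s ∈ ss, s.OK emin) → acc + xsum ss ≤ (1 + placeUW q p false w) * lchainEval acc ss) ∧
    (∀ (emin E : ℤ) (w : List Bool), emin + q ≤ E →
        ∃ (acc : ℚ) (ws : List LStep), ws.map lpat = placePatW q p false w ∧
          IsFloat p emin acc ∧ (∀ s ∈ ws, s.OK emin) ∧ lchainEval acc ws = (2 : ℚ) ^ E ∧
          acc + xsum ws = (1 + placeUW q p false w) * lchainEval acc ws) ∧
    (∀ w : List Bool,
        (nN w : ℚ) * unitRoundoff p + (nW w : ℚ) * unitRoundoff q ≤ placeUW q p false w) ∧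
    (∀ w : List Bool,
        placeUW q p false w = (nN w : ℚ) * unitRoundoff p + (nW w : ℚ) * unitRoundoff q ↔
          ∃ a k : ℕ, w = List.replicate a false ++ List.replicate k true) ∧
    (∀ a k : ℕ, placeUW q p false (List.replicate a false ++ List.replicate (k + 1) true)
        < ((a + (k + 1) : ℕ) : ℚ) * unitRoundoff p) ∧
    (∀ a k c : ℕ, placeU q p false (contig a (k + 1) c)
        = placeUW q p false (List.replicate (a + c) false ++ List.replicate (k + 1) true)
            + unitRoundoff p)

/-- `R4_PlacementLawWide` holds. -/
theorem R4_PlacementLawWide_holds : R4_PlacementLawWide := by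
  intro q p hp hpq
  refine ⟨fun emin w ss acc hpat hacc0 haccF hok =>
      placementW_exact_le hpq w ss hpat acc hacc0 haccF hok, ?_, placeUW_ge q p false,
      placeUW_eq_min_iff q p, placeUW_suffix_lt_allNarrow hpq, placeU_contig_eq_placeUW_suffix_add q p⟩
  intro emin E w hE
  obtain ⟨fl, hfl⟩ := exists_tiesDown_family emin
  obtain ⟨hmap, hok, hev, heq⟩ := placementW_attained hfl hp hpq hE w
  refine ⟨(2 : ℚ) ^ E, witSteps fl E (placePatW q p false w), hmap, ?_, hok, hev, ?_⟩
  · exact PTree.isFloat_two_zpow hp (by omega)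
  · rw [hev]; exact heq

/-- THE PLACEMENT LAW WITH WIDE DELIVERY UNDER ROUND-TO-NEAREST-EVEN (T9(h′)): (1) `2 ≤ p`,
`p + 2 ≤ q`: for every placement, scale `E ≥ emin + q` and EVERY ties-to-even family the witness
chain with those roundings from `acc = 2^E` has `S_n = 2^E` and `acc + Σ x_i = (1 + UW(w)) S_n`;
(2) `q = p + 1`: every admissible ties-to-even chain executing a placement WITH A DEMOTION, from
`acc ∈ F(p)`, `acc ≥ 0`, `S_n > 0`, has `acc + Σ x_i < (1 + Σ u_{π_i}) S_n`; (3) the placements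
without a demotion are exactly the suffix placements. -/
def R4_PlacementLawWideRNE : Prop :=
  (∀ (q p : ℕ), 2 ≤ p → p + 2 ≤ q → ∀ (emin E : ℤ) (w : List Bool), emin + q ≤ E →
    ∀ fl : ℕ → ℚ → ℚ, (∀ π, IsRoundNearest π emin (fl π) ∧ TiesToEven π emin (fl π)) →
      ∃ ws : List LStep, ws.map lpat = placePatW q p false w ∧ (∀ s ∈ ws, s.fl = fl s.prec) ∧
        (∀ s ∈ ws, s.OK emin) ∧ lchainEval ((2 : ℚ) ^ E) ws = (2 : ℚ) ^ E ∧
        (2 : ℚ) ^ E + xsum ws = (1 + placeUW q p false w) * lchainEval ((2 : ℚ) ^ E) ws) ∧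
  (∀ (p : ℕ) (emin : ℤ) (w : List Bool), demots false w ≠ 0 → ∀ (ss : List LStep) (acc : ℚ),
    ss.map lpat = placePatW (p + 1) p false w → 0 ≤ acc → IsFloat p emin acc →
    (∀ s ∈ ss, s.OK emin ∧ TiesToEven s.prec emin s.fl) → 0 < lchainEval acc ss →
    acc + xsum ss < (1 + usum ss) * lchainEval acc ss) ∧
  (∀ w : List Bool,
    demots false w = 0 ↔ ∃ a k : ℕ, w = List.replicate a false ++ List.replicate k true)

/-- `R4_PlacementLawWideRNE` holds. -/
theorem R4_PlacementLawWideRNE_holds : R4_PlacementLawWideRNE := by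
  refine ⟨?_, fun p emin w hw ss acc hpat hacc0 haccF hss hpos =>
    placementW_rne_strict w hw ss hpat acc hacc0 haccF hss hpos, demots_eq_zero_iff⟩
  intro q p hp h2 emin E w hE fl hfl
  obtain ⟨hmap, hok, hev, heq⟩ := placementW_rne_attained hfl hp h2 hE w
  refine ⟨witSteps fl E (placePatW q p false w), hmap, fl_witSteps fl E _, hok, hev, ?_⟩
  rw [hev]; exact heq

end Summit.Ventures.CertifiedArithmetic.LowPrec.Opt
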